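import Summits.QuantumFields.YangMills.Theorems.BalabanLadderUVOtherGroupsClasses
import HarnessLib

/-!
# Route `BalabanLadder`, crux `UVOtherGroups` (stmt-QuantumFields-19356): the class split, CURRENCY-AGNOSTIC

Helper file (`--supports stmt-QuantumFields-19356`, fleet seat `ym-osasm-p2`, director-ym R136 (iii)); pure theorems, logic over the tree's
`suClass_trichotomy` and `isCompactSimpleLieGroup_of_equiv_sun` (`Theorems/BalabanLadderUVOtherGroupsClasses.lean`, p460623).

WHY.  The bridge consumes, for every compact simple `G`, ONE «legs package» `P G`; the residual leg's R85 cut serves it from three pieces —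
the `SU(2)` class (spine `UV`·`UVSeamRec`), the piece stated AT `SU(N)` for `N ≥ 3` (`UVApexSUN`·`UVSeamWitnessSUN`), the non-`SU(N)` record residual
(`UVNonSUNRec`) — and `legsWitnessAll_iff_classes` (p460623) certified that split lossless IN TODAY'S CURRENCY
`P G := ∃ r a, 0 < a ∧ a → 0 ∧ LowerBounds G r a ∧ MomentBounds6 G r a`.  The currency is about to change (owner ruling on the torus-parity junction,
2026-08-26T18:15:51Z, direction (c′): class-parametric `…OnSides G r a 𝓣`, KNIT 5; possibly again at (α)).  The split itself uses exactly ONE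
property of the currency: **transport along `G ≃ₜ* SU(N)`** (Haar uniqueness).  This file proves it ONCE for an arbitrary property `P` of compact
topological groups with that transport, so that every future currency is served by a one-line instance:

* §1 `forall_compactSimple_iff_classes` — `(∀ G simple, P G) ↔ (SU(2) class) ∧ (∀ N ≥ 3, P SU(N)) ∧ (non-SU(N) residual)`;
  `forall_compactSimple_iff_sun_and_nonSUN` — the `SU(2)` class collapses too: `(∀ G simple, P G) ↔ (∀ N ≥ 2, P SU(N)) ∧ (non-SU(N) residual)`;
  one-way assembly forms `forall_compactSimple_of_classes` ∕ `_of_sun_and_nonSUN` (what a `closes` body calls).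
* §2 Instance = today's currency: `legsWitnessAll_iff_sun_and_nonSUN` — the bridge's UV-side input in record form ↔ «the legs witness AT `SU(N)`
  for every `N ≥ 2`» ∧ «the non-`SU(N)` record residual» (new normal form: the `SU(2)` class is the witness AT `SU(2)`; transport =
  `legsWitness_of_continuousMulEquiv`); the landed three-component `legsWitnessAll_iff_classes` (p460623) is `forall_compactSimple_iff_classes`
  at the same `P` and the same transport (one line; not re-declared, gate dedup); `legsWitness_sunAll_of_items` assembles the `SU(N)` conjunct of
  the normal form from the spine's `UV`·`UVSeamRec` (AT `SU(2)`) and the R85 pieces `∀ N ≥ 3, UVD59 N`·`UVSeamWitnessSUN` (AT `SU(N ≥ 3)`).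

The class-parametric instance (`MomentBounds6OnSides`, transport `Cruxes.UV.TorusClass.momentBounds6OnSides_of_continuousMulEquiv`) follows in
the sibling file once the floors half `LowerBoundsOnSides` is typed (KNIT 5 k2).  HONEST FRAMING: bookkeeping of a CONDITIONAL chain (0∕6 legs
discharged); logic only; not a gap, not Clay.
-/

set_option autoImplicit false

noncomputable section

open MeasureTheory Filter Topology
open Literature.MathematicalPhysics.QuantumFieldTheory
open Summit.QuantumFields.YangMills.Cruxes.OSLegsFromFemtoAndGap.DlrCollarTransfer

namespace Summit.QuantumFields.YangMills.Theorems.UVOtherGroups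

/-! ## §1 The split for an arbitrary transportable property of compact groups -/

section Generic

-- A «junction currency»: a property `P` of compact topological groups (instance arguments as the bridge binds them).
variable {P : ∀ (G : Type) [Group G] [TopologicalSpace G] [IsTopologicalGroup G] [CompactSpace G], Prop}

/-- **THE CLASS SPLIT, currency-agnostic.**  Let `P` be any property of compact topological groups that TRANSPORTS from `SU(N)` to every
`G ≃ₜ* SU(N)` (the one use of Haar uniqueness).  Then «`P G` for every compact simple Lie `G`» is EQUIVALENT to the conjunction of its three
class components: the `SU(2)` class · `P SU(N)` for every `N ≥ 3` · the non-`SU(N)` residual.  (`SU(N)`, `N ≥ 2`, is compact simple Lie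
unconditionally, `isCompactSimpleLieGroup_of_equiv_sun`; trichotomy `suClass_trichotomy`.) -/
theorem forall_compactSimple_iff_classes
    (hP : ∀ {G : Type} [Group G] [TopologicalSpace G] [IsTopologicalGroup G] [CompactSpace G] {N : ℕ} [NeZero N],
      (G ≃ₜ* Matrix.specialUnitaryGroup (Fin N) ℂ) → P (Matrix.specialUnitaryGroup (Fin N) ℂ) → P G) :
    (∀ (G : Type) [Group G] [TopologicalSpace G] [IsTopologicalGroup G] [CompactSpace G], IsCompactSimpleLieGroup G → P G) ↔
      (∀ (G : Type) [Group G] [TopologicalSpace G] [IsTopologicalGroup G] [CompactSpace G],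
          IsCompactSimpleLieGroup G → Nonempty (G ≃ₜ* Matrix.specialUnitaryGroup (Fin 2) ℂ) → P G) ∧
      (∀ (N : ℕ) [NeZero N], 3 ≤ N → P (Matrix.specialUnitaryGroup (Fin N) ℂ)) ∧
      (∀ (G : Type) [Group G] [TopologicalSpace G] [IsTopologicalGroup G] [CompactSpace G],
          IsCompactSimpleLieGroup G → (∀ N : ℕ, 2 ≤ N → IsEmpty (G ≃ₜ* Matrix.specialUnitaryGroup (Fin N) ℂ)) → P G) := by
  refine ⟨fun h => ⟨fun G _ _ _ _ hG _ => h G hG, fun N _ hN => h _ (isCompactSimpleLieGroup_of_equiv_sun (N := N) (by omega)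
    (ContinuousMulEquiv.refl _)), fun G _ _ _ _ hG _ => h G hG⟩, fun h G _ _ _ _ hG => ?_⟩
  rcases suClass_trichotomy G with hcl | ⟨N, hN3, ⟨e⟩⟩ | hno
  · exact h.1 G hG hcl
  · haveI : NeZero N := ⟨by omega⟩
    exact hP e (h.2.1 N hN3)
  · exact h.2.2 G hG hno

/-- **The `SU(2)` class collapses as well**: with transport, «`P G` for every compact simple Lie `G`» ↔ «`P SU(N)` for every `N ≥ 2`» ∧
«the non-`SU(N)` residual».  (So a currency's `SU(N)` content is exactly its values AT the matrix groups `SU(N)`, `N ≥ 2`.) -/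
theorem forall_compactSimple_iff_sun_and_nonSUN
    (hP : ∀ {G : Type} [Group G] [TopologicalSpace G] [IsTopologicalGroup G] [CompactSpace G] {N : ℕ} [NeZero N],
      (G ≃ₜ* Matrix.specialUnitaryGroup (Fin N) ℂ) → P (Matrix.specialUnitaryGroup (Fin N) ℂ) → P G) :
    (∀ (G : Type) [Group G] [TopologicalSpace G] [IsTopologicalGroup G] [CompactSpace G], IsCompactSimpleLieGroup G → P G) ↔
      (∀ (N : ℕ) [NeZero N], 2 ≤ N → P (Matrix.specialUnitaryGroup (Fin N) ℂ)) ∧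
      (∀ (G : Type) [Group G] [TopologicalSpace G] [IsTopologicalGroup G] [CompactSpace G],
          IsCompactSimpleLieGroup G → (∀ N : ℕ, 2 ≤ N → IsEmpty (G ≃ₜ* Matrix.specialUnitaryGroup (Fin N) ℂ)) → P G) := by
  refine ⟨fun h => ⟨fun N _ hN => h _ (isCompactSimpleLieGroup_of_equiv_sun (N := N) hN (ContinuousMulEquiv.refl _)),
    fun G _ _ _ _ hG _ => h G hG⟩, fun h G _ _ _ _ hG => ?_⟩
  rcases suClass_trichotomy G with hcl | ⟨N, hN3, ⟨e⟩⟩ | hno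
  · obtain ⟨e⟩ := hcl
    exact hP e (h.1 2 le_rfl)
  · haveI : NeZero N := ⟨by omega⟩
    exact hP e (h.1 N (by omega))
  · exact h.2 G hG hno

/-- Assembly form of `forall_compactSimple_iff_classes` (what a `closes` body calls): the three class components give `P` on every compact
simple Lie group. -/
theorem forall_compactSimple_of_classes
    (hP : ∀ {G : Type} [Group G] [TopologicalSpace G] [IsTopologicalGroup G] [CompactSpace G] {N : ℕ} [NeZero N],
      (G ≃ₜ* Matrix.specialUnitaryGroup (Fin N) ℂ) → P (Matrix.specialUnitaryGroup (Fin N) ℂ) → P G)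
    (h₂ : ∀ (G : Type) [Group G] [TopologicalSpace G] [IsTopologicalGroup G] [CompactSpace G],
      IsCompactSimpleLieGroup G → Nonempty (G ≃ₜ* Matrix.specialUnitaryGroup (Fin 2) ℂ) → P G)
    (hN : ∀ (N : ℕ) [NeZero N], 3 ≤ N → P (Matrix.specialUnitaryGroup (Fin N) ℂ))
    (hNon : ∀ (G : Type) [Group G] [TopologicalSpace G] [IsTopologicalGroup G] [CompactSpace G],
      IsCompactSimpleLieGroup G → (∀ N : ℕ, 2 ≤ N → IsEmpty (G ≃ₜ* Matrix.specialUnitaryGroup (Fin N) ℂ)) → P G) :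
    ∀ (G : Type) [Group G] [TopologicalSpace G] [IsTopologicalGroup G] [CompactSpace G], IsCompactSimpleLieGroup G → P G :=
  (forall_compactSimple_iff_classes hP).2 ⟨h₂, hN, hNon⟩

/-- Assembly form of `forall_compactSimple_iff_sun_and_nonSUN`: `P` at every `SU(N)`, `N ≥ 2`, and the non-`SU(N)` residual give `P` on
every compact simple Lie group. -/
theorem forall_compactSimple_of_sun_and_nonSUN
    (hP : ∀ {G : Type} [Group G] [TopologicalSpace G] [IsTopologicalGroup G] [CompactSpace G] {N : ℕ} [NeZero N],
      (G ≃ₜ* Matrix.specialUnitaryGroup (Fin N) ℂ) → P (Matrix.specialUnitaryGroup (Fin N) ℂ) → P G)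
    (hSU : ∀ (N : ℕ) [NeZero N], 2 ≤ N → P (Matrix.specialUnitaryGroup (Fin N) ℂ))
    (hNon : ∀ (G : Type) [Group G] [TopologicalSpace G] [IsTopologicalGroup G] [CompactSpace G],
      IsCompactSimpleLieGroup G → (∀ N : ℕ, 2 ≤ N → IsEmpty (G ≃ₜ* Matrix.specialUnitaryGroup (Fin N) ℂ)) → P G) :
    ∀ (G : Type) [Group G] [TopologicalSpace G] [IsTopologicalGroup G] [CompactSpace G], IsCompactSimpleLieGroup G → P G :=
  (forall_compactSimple_iff_sun_and_nonSUN hP).2 ⟨hSU, hNon⟩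

/-- **On an `SU(N)` class the value of `P` is its value AT `SU(N)`**: `P G ↔ P SU(N)` for every `G ≃ₜ* SU(N)` (transport along `e` and
along `e.symm`; the transport hypothesis is taken general in the target group). -/
theorem iff_sun_of_continuousMulEquiv
    (hP : ∀ {G H : Type} [Group G] [TopologicalSpace G] [IsTopologicalGroup G] [CompactSpace G]
      [Group H] [TopologicalSpace H] [IsTopologicalGroup H] [CompactSpace H], (G ≃ₜ* H) → P H → P G)
    {G : Type} [Group G] [TopologicalSpace G] [IsTopologicalGroup G] [CompactSpace G] {N : ℕ} [NeZero N]
    (e : G ≃ₜ* Matrix.specialUnitaryGroup (Fin N) ℂ) :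
    P G ↔ P (Matrix.specialUnitaryGroup (Fin N) ℂ) :=
  ⟨hP e.symm, hP e⟩

end Generic

/-! ## §2 Instance: today's currency (the legs witness in record form) -/

/-- **The bridge's UV-side input in record form ↔ «the legs witness AT `SU(N)` for every `N ≥ 2`» ∧ «the non-`SU(N)` record residual»**
(`forall_compactSimple_iff_sun_and_nonSUN` at `P G := ∃ r a, 0 < a ∧ a → 0 ∧ LowerBounds G r a ∧ MomentBounds6 G r a` with `G`'s Borel σ-algebra;
transport = `legsWitness_of_continuousMulEquiv`).  Normal form of `legsWitnessAll_iff_classes` in which the `SU(2)` class is the witness AT `SU(2)`. -/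
theorem legsWitnessAll_iff_sun_and_nonSUN :
    (∀ (G : Type) [Group G] [TopologicalSpace G] [IsTopologicalGroup G] [CompactSpace G],
      IsCompactSimpleLieGroup G → letI : MeasurableSpace G := borel G; haveI : BorelSpace G := ⟨rfl⟩;
      ∃ (r : LatticeRep G) (a : ℝ → ℝ), (∀ β, 0 < a β) ∧ Tendsto a atTop (𝓝 0) ∧ LowerBounds G r a ∧ MomentBounds6 G r a) ↔
    (∀ (N : ℕ) [NeZero N], 2 ≤ N →
      ∃ (r : LatticeRep (Matrix.specialUnitaryGroup (Fin N) ℂ)) (a : ℝ → ℝ), (∀ β, 0 < a β) ∧ Tendsto a atTop (𝓝 0) ∧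
        LowerBounds (Matrix.specialUnitaryGroup (Fin N) ℂ) r a ∧ MomentBounds6 (Matrix.specialUnitaryGroup (Fin N) ℂ) r a) ∧
    (∀ (G : Type) [Group G] [TopologicalSpace G] [IsTopologicalGroup G] [CompactSpace G],
      IsCompactSimpleLieGroup G → (∀ N : ℕ, 2 ≤ N → IsEmpty (G ≃ₜ* Matrix.specialUnitaryGroup (Fin N) ℂ)) →
      letI : MeasurableSpace G := borel G; haveI : BorelSpace G := ⟨rfl⟩;
      ∃ (r : LatticeRep G) (a : ℝ → ℝ), (∀ β, 0 < a β) ∧ Tendsto a atTop (𝓝 0) ∧ LowerBounds G r a ∧ MomentBounds6 G r a) :=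
  forall_compactSimple_iff_sun_and_nonSUN
    (P := fun G _ _ _ _ => letI : MeasurableSpace G := borel G; haveI : BorelSpace G := ⟨rfl⟩;
      ∃ (r : LatticeRep G) (a : ℝ → ℝ), (∀ β, 0 < a β) ∧ Tendsto a atTop (𝓝 0) ∧ LowerBounds G r a ∧ MomentBounds6 G r a)
    fun {G} _ _ _ _ {N} _ e h => by
      letI : MeasurableSpace G := borel G
      haveI : BorelSpace G := ⟨rfl⟩
      exact legsWitness_of_continuousMulEquiv e h

/-- **Assembly in the new normal form**: the legs witness AT every `SU(N)`, `N ≥ 2`, and the non-`SU(N)` record residual give the bridge's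
UV-side input for every compact simple Lie `G`. -/
theorem legsWitnessAll_of_sun_and_nonSUN
    (hSU : ∀ (N : ℕ) [NeZero N], 2 ≤ N →
      ∃ (r : LatticeRep (Matrix.specialUnitaryGroup (Fin N) ℂ)) (a : ℝ → ℝ), (∀ β, 0 < a β) ∧ Tendsto a atTop (𝓝 0) ∧
        LowerBounds (Matrix.specialUnitaryGroup (Fin N) ℂ) r a ∧ MomentBounds6 (Matrix.specialUnitaryGroup (Fin N) ℂ) r a)
    (hNon : ∀ (G : Type) [Group G] [TopologicalSpace G] [IsTopologicalGroup G] [CompactSpace G],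
      IsCompactSimpleLieGroup G → (∀ N : ℕ, 2 ≤ N → IsEmpty (G ≃ₜ* Matrix.specialUnitaryGroup (Fin N) ℂ)) →
      letI : MeasurableSpace G := borel G; haveI : BorelSpace G := ⟨rfl⟩;
      ∃ (r : LatticeRep G) (a : ℝ → ℝ), (∀ β, 0 < a β) ∧ Tendsto a atTop (𝓝 0) ∧ LowerBounds G r a ∧ MomentBounds6 G r a) :
    ∀ (G : Type) [Group G] [TopologicalSpace G] [IsTopologicalGroup G] [CompactSpace G],
      IsCompactSimpleLieGroup G → letI : MeasurableSpace G := borel G; haveI : BorelSpace G := ⟨rfl⟩;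
      ∃ (r : LatticeRep G) (a : ℝ → ℝ), (∀ β, 0 < a β) ∧ Tendsto a atTop (𝓝 0) ∧ LowerBounds G r a ∧ MomentBounds6 G r a :=
  legsWitnessAll_iff_sun_and_nonSUN.2 ⟨hSU, hNon⟩

/-- **The witness piece AT `SU(N)`, `N ≥ 2`, from the spine's `SU(2)` pair and the R85 `SU(N ≥ 3)` pieces** — the left conjunct of the new
normal form, assembled from the items: `UV`·`UVSeamRec` give the witness AT `SU(2)` (the class component at `G := SU(2)`,
`legsWitness_su2Class_of_uv_uvSeamRec`), the apex keys `∀ N ≥ 3, UVD59 N` and `UVSeamWitnessSUN` give it AT `SU(N ≥ 3)`. -/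
theorem legsWitness_sunAll_of_items (hUV : Summit.QuantumFields.YangMills.Theses.BalabanLadder.UV)
    (hSeam : Summit.QuantumFields.YangMills.Theses.BalabanLadder.UVSeamRec)
    (hApex : ∀ (N : ℕ) [NeZero N], 3 ≤ N → YMDAG.UVSplit.UVD59 N) (hWit : UVSeamWitnessSUN) :
    ∀ (N : ℕ) [NeZero N], 2 ≤ N →
      ∃ (r : LatticeRep (Matrix.specialUnitaryGroup (Fin N) ℂ)) (a : ℝ → ℝ), (∀ β, 0 < a β) ∧ Tendsto a atTop (𝓝 0) ∧
        LowerBounds (Matrix.specialUnitaryGroup (Fin N) ℂ) r a ∧ MomentBounds6 (Matrix.specialUnitaryGroup (Fin N) ℂ) r a := by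
  intro N _ hN
  by_cases h2 : N = 2
  · subst h2
    exact legsWitness_su2Class_of_uv_uvSeamRec hUV hSeam _
      (isCompactSimpleLieGroup_of_equiv_sun (N := 2) le_rfl (ContinuousMulEquiv.refl _)) ⟨ContinuousMulEquiv.refl _⟩
  · exact hWit N (by omega) (hApex N (by omega))

end Summit.QuantumFields.YangMills.Theorems.UVOtherGroups

end
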